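import Summits.QuantumFields.YangMills.Theorems.ConvexGribovBodyNonSimplyConnectedLatticeGapTwistDefs
import HarnessLib

/-!
# Line `equipartition_seam` (crux `IRcof`, stmt-QuantumFields-26930): the UNIT-CURRENCY predicates (definitions only)

§0–§1 of the registered skeleton `Cruxes/IRcof/Lines/equipartition_seam.lean` rev 4, VERBATIM (same namespace, same names), extracted so that
Theorems files proving the line's stubs (`…EquipartitionSeamMixUnits`, S7) and the skeleton itself (rev 5, which drops its copy and imports
this file) share ONE set of constants: `Plane`, `Sector`, `Labelling`, `EquiUnitOn`, `EBlindUnitOn`, `PscUnitOn`, `BadUnitOn`, `CoverGapCof`,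
and the three sanity lemmas `twistEquiAt_of_equiUnitOn`, `twistEBlindAt_of_eblindUnitOn`, `twistBadRareAt_of_badUnitOn` (the unit
predicates imply the tree's per-β vocabulary of crux 16405's `TwistDefs`).

HONEST LABEL.  The Yang–Mills mass gap (Clay) is NOT proved; `IRcof` ∕ `IR` 0 ∕ 1; census row 47 class PWP unchanged (walls S3 ∕ S5ᵛ
untouched); nothing continuum ∕ OS ∕ Clay.  Source: ideator `ym-ir-idea-22` g4, workfile `Cruxes/IRcof/Lines/equipartition_seam_MixUnits.lean`
(crux write 11a4c1684aae), verbatim.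
-/

set_option autoImplicit false

noncomputable section

open Filter Topology MeasureTheory
open Literature.MathematicalPhysics.QuantumFieldTheory Literature.MathematicalPhysics.QuantumLattice
open Summit.QuantumFields.YangMills.Theorems.NonSimplyConnectedLatticeGap

namespace Summit.QuantumFields.YangMills.Cruxes.IRcof.EquipartitionSeam

/-! ## PART U — §0–§1 of the skeleton, verbatim (unit predicates) -/

/-! ## §0 Abbreviations (reducible; they unfold to the tree's literal types) -/

/-- The six coordinate planes of the four-torus. -/
abbrev Plane : Type := {p : Fin 4 × Fin 4 // p.1 < p.2}

/-- A 't Hooft flux sector of the cover datum: one kernel element per plane. -/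
abbrev Sector {G H : Type} [Group G] [Group H] (π : H →* G) : Type := Plane → ↥π.ker

/-- A labelling family: one `Option Sector`-valued labelling per symmetric torus `(2S+1)⁴`. -/
abbrev Labelling {G H : Type} [Group G] [Group H] (π : H →* G) : Type :=
  ∀ S : ℕ, GaugeConfig 4 (2 * S + 1) H → Option (Sector π)

/-! ## §1 Per-torus predicates in UNIT currency (rate and constants exposed) -/

section PerDatum

variable {G H : Type} [Group G] [TopologicalSpace G] [MeasurableSpace G] [Group H] [TopologicalSpace H]
  [IsTopologicalGroup H] [CompactSpace H] [MeasurableSpace H] [BorelSpace H]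

/-- **EQUI in unit currency at `β` beyond `S_e`**: on every torus `S ≥ S_e`, two sectors differing only in ELECTRIC
slots have weights with `|p_z − p_w| ≤ e^{−(2S+1)} p_w` (rate 1, constant 1 — the threshold `S_e` absorbs the
string-tension scale). -/
def EquiUnitOn (π : H →* G) (r : LatticeRep G) (β : ℝ) (cls : Labelling π) (S_e : ℕ) : Prop :=
  ∀ (S : ℕ) (z w : Sector π), S_e ≤ S → (∀ q : Plane, q.1.1 ≠ 0 → z q = w q) →
    |((wilsonMeasure (r.ρ.comp π) β : Measure (GaugeConfig 4 (2 * S + 1) H)) ((cls S) ⁻¹' {some z})).toReal -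
      ((wilsonMeasure (r.ρ.comp π) β : Measure (GaugeConfig 4 (2 * S + 1) H)) ((cls S) ⁻¹' {some w})).toReal| ≤
      Real.exp (-(2 * (S : ℝ) + 1)) *
        ((wilsonMeasure (r.ρ.comp π) β : Measure (GaugeConfig 4 (2 * S + 1) H)) ((cls S) ⁻¹' {some w})).toReal

/-- **EBLIND in unit currency at `β` beyond `S_b` for ONE species `A` with constant `C`**:
`|p_w ∫_{E_z} Ã − p_z ∫_{E_w} Ã| ≤ C e^{−(2S+1)} p_z p_w` for electrically related `z, w`, `S ≥ S_b`. -/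
def EBlindUnitOn (π : H →* G) (r : LatticeRep G) (β : ℝ) (cls : Labelling π) (S_b : ℕ) (A : YMSpecies G)
    (C : ℝ) : Prop :=
  ∀ (S : ℕ) (z w : Sector π), S_b ≤ S → (∀ q : Plane, q.1.1 ≠ 0 → z q = w q) →
    |((wilsonMeasure (r.ρ.comp π) β : Measure (GaugeConfig 4 (2 * S + 1) H)) ((cls S) ⁻¹' {some w})).toReal *
        (∫ V in ((cls S) ⁻¹' {some z}), A.F (fun e => π (torusLift (2 * S + 1) V e))
          ∂(wilsonMeasure (r.ρ.comp π) β : Measure (GaugeConfig 4 (2 * S + 1) H))) -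
      ((wilsonMeasure (r.ρ.comp π) β : Measure (GaugeConfig 4 (2 * S + 1) H)) ((cls S) ⁻¹' {some z})).toReal *
        (∫ V in ((cls S) ⁻¹' {some w}), A.F (fun e => π (torusLift (2 * S + 1) V e))
          ∂(wilsonMeasure (r.ρ.comp π) β : Measure (GaugeConfig 4 (2 * S + 1) H)))| ≤
      C * Real.exp (-(2 * (S : ℝ) + 1)) *
        ((wilsonMeasure (r.ρ.comp π) β : Measure (GaugeConfig 4 (2 * S + 1) H)) ((cls S) ⁻¹' {some z})).toReal *
        ((wilsonMeasure (r.ρ.comp π) β : Measure (GaugeConfig 4 (2 * S + 1) H)) ((cls S) ⁻¹' {some w})).toReal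

/-- **PSC in unit currency at `β` beyond `S_p` for species `A, B` with constant `C` and rate `m`** (junk-safe at
`p_z = 0`): `|∫_{E_z} Ã B̃_n − p_z⁻¹ ∫_{E_z} Ã ∫_{E_z} B̃_n| ≤ C e^{−m n} p_z` for `S_p ≤ S`, `n ≤ S`. -/
def PscUnitOn (π : H →* G) (r : LatticeRep G) (β : ℝ) (cls : Labelling π) (S_p : ℕ) (A B : YMSpecies G)
    (C m : ℝ) : Prop :=
  ∀ (S n : ℕ) (z : Sector π), S_p ≤ S → n ≤ S →
    |(∫ V in ((cls S) ⁻¹' {some z}), A.F (fun e => π (torusLift (2 * S + 1) V e)) *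
          B.F (fun e => π (configShift (-Pi.single 0 (n : ℤ)) (torusLift (2 * S + 1) V) e))
          ∂(wilsonMeasure (r.ρ.comp π) β : Measure (GaugeConfig 4 (2 * S + 1) H))) -
      (((wilsonMeasure (r.ρ.comp π) β : Measure (GaugeConfig 4 (2 * S + 1) H)) ((cls S) ⁻¹' {some z})).toReal)⁻¹ *
        (∫ V in ((cls S) ⁻¹' {some z}), A.F (fun e => π (torusLift (2 * S + 1) V e))
          ∂(wilsonMeasure (r.ρ.comp π) β : Measure (GaugeConfig 4 (2 * S + 1) H))) *
        (∫ V in ((cls S) ⁻¹' {some z}),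
          B.F (fun e => π (configShift (-Pi.single 0 (n : ℤ)) (torusLift (2 * S + 1) V) e))
          ∂(wilsonMeasure (r.ρ.comp π) β : Measure (GaugeConfig 4 (2 * S + 1) H)))| ≤
      C * Real.exp (-(m * n)) *
        ((wilsonMeasure (r.ρ.comp π) β : Measure (GaugeConfig 4 (2 * S + 1) H)) ((cls S) ⁻¹' {some z})).toReal

/-- **Bad event at rate 1 beyond `S_c` with constant `C`**: `μ̃_β(cls_S⁻¹{none}) ≤ C e^{−S}` for `S ≥ S_c`. -/
def BadUnitOn (π : H →* G) (r : LatticeRep G) (β : ℝ) (cls : Labelling π) (S_c : ℕ) (C : ℝ) : Prop :=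
  ∀ S : ℕ, S_c ≤ S →
    ((wilsonMeasure (r.ρ.comp π) β : Measure (GaugeConfig 4 (2 * S + 1) H)) ((cls S) ⁻¹' {none})).toReal ≤
      C * Real.exp (-(S : ℝ))

/-- **The cover theory clusters in the units `au` on a cofinal set of couplings** (the H-side image of `IRnscCof`'s
conclusion: pulled-back species, constants uniform over the set, thresholds `S₁(β)`). -/
def CoverGapCof (π : H →* G) (r : LatticeRep G) (au : ℝ → ℝ) : Prop :=
  ∃ Bset : Set ℝ, (∀ x : ℝ, ∃ β ∈ Bset, x ≤ β) ∧ ∃ (c₁ β₂ : ℝ) (S₁ : ℝ → ℕ), 0 < c₁ ∧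
    ∀ A B : YMSpecies G, ∃ C : ℝ, ∀ β ∈ Bset, β₂ ≤ β → ∀ S n : ℕ, S₁ β ≤ S → n ≤ S →
      |latticeConnectedCorr (r.ρ.comp π) β (2 * S + 1) (fun V => A.F (fun e => π (V e)))
          (fun V => B.F (fun e => π (V e))) n| ≤ C * Real.exp (-(c₁ * au β * n))

/-! ### Sanity: the unit predicates imply the tree's per-β vocabulary (nothing asserted) -/

omit [TopologicalSpace G] [MeasurableSpace G] in
/-- Unit equipartition beyond `S_e` IS the tree's `TwistEquiAt` with `μ = 1`, `C = 1`. -/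
theorem twistEquiAt_of_equiUnitOn [TopologicalSpace G] (π : H →* G) (r : LatticeRep G) (β : ℝ) (cls : Labelling π)
    (S_e : ℕ) (h : EquiUnitOn π r β cls S_e) : TwistEquiAt π r β cls := by
  refine ⟨1, one_pos, S_e, 1, fun S z w hS hzw => ?_⟩
  simpa only [one_mul] using h S z w hS hzw

/-- Unit blindness with uniform threshold IS the tree's `TwistEBlindAt` with `μ = 1` (small tori absorbed into the
constant through the trivial bound `2‖A‖ p_z p_w`, which is why no species threshold is needed — here we only
record the implication when the threshold is `0`). -/
theorem twistEBlindAt_of_eblindUnitOn (π : H →* G) (r : LatticeRep G) (β : ℝ) (cls : Labelling π)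
    (h : ∀ A : YMSpecies G, ∃ C : ℝ, EBlindUnitOn π r β cls 0 A C) : TwistEBlindAt π r β cls := by
  refine ⟨1, one_pos, fun A => ?_⟩
  obtain ⟨C, hC⟩ := h A
  refine ⟨C, fun S z w hzw => ?_⟩
  simpa only [one_mul] using hC S z w (Nat.zero_le S) hzw

omit [TopologicalSpace G] [MeasurableSpace G] in
/-- Rate-1 bad rarity from threshold `0` IS the tree's `TwistBadRareAt` with `c = 1`. -/
theorem twistBadRareAt_of_badUnitOn [TopologicalSpace G] (π : H →* G) (r : LatticeRep G) (β : ℝ)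
    (cls : Labelling π) (C : ℝ) (h : BadUnitOn π r β cls 0 C) : TwistBadRareAt π r β cls := by
  refine ⟨1, one_pos, C, fun S => ?_⟩
  simpa only [one_mul] using h S (Nat.zero_le S)

end PerDatum

/-! ## §2 The line's statements (each universally closed over cover data `DB`) -/

end Summit.QuantumFields.YangMills.Cruxes.IRcof.EquipartitionSeam
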